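import Literature.Analysis.SpecialFunctions.RiemannThetaLefschetz
import Mathlib.Analysis.Calculus.FDeriv.Pow
import HarnessLib

/-!
# Lefschetz's theorem for `ϑ(·, Ω)` at level `d ≥ 3`: products of `d` translates separate points and tangent vectors

Let `Ω` be symmetric with `Im Ω ≥ c > 0` (e.g. `Ω` in the Siegel upper half space) and
`ϑ = ϑ(·, Ω)` the Riemann theta function (`RiemannTheta.lean`), whose divisor `Θ = {ϑ = 0}` is the
theta divisor of the principal polarisation `L₀` of the torus `X = ℂ^g/(ℤ^g ⊕ Ωℤ^g)`.

Lange's **Theorem of Lefschetz** (*Abelian Varieties over the Complex Numbers*, Thm. 2.1.10 =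
Lange–Birkenhake Thm. 4.5.1): *if `L` is a positive line bundle of type `(d₁, …, d_g)` with
`d₁ ≥ 3`, then `φ_L : X → ℙⁿ` is an embedding.* The printed proof writes `L = M^{d₁}` and works,
for BOTH parts (i) "`φ_L` injective" and (ii) "`dφ_{L,x}` injective", with the divisors

  `Σ_{v=1}^{d₁} t*_{x_v} D_M ∈ |L|`,  `x₁ + ⋯ + x_{d₁} = 0`  (Lemma 2.1.4, theorem of the square),

choosing the auxiliary translates `x₂, …, x_{d₁}` off the points under consideration ("by
continuity of the addition map and since `d₁ ≥ 3`"). For `M = L₀` these divisors are cut out by the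
entire functions

  `P_x(z) = ∏_{v=1}^{d} ϑ(z + x_v)`,  `x : Fin d → ℂ^g`, `Σ_v x_v = 0`,

and the tree so far contains the first case `d = 3` of the theorem, in the parametrisation
`x = (a, b, -a-b)`: `riemannTheta_lattice_of_cubic_translate` / `riemannTheta_tangent_of_cubic_leibniz`
(`RiemannThetaLefschetz.lean`) and their packaging `riemannTheta_cubic_separatesPoints` /
`riemannTheta_cubic_separatesTangents` (`RiemannThetaLefschetzSteps.lean`). This file proves the
theorem AT ITS PRINTED LEVEL `d ≥ 3` (and Prop. 2.1.5 at its printed level `d ≥ 2`) for `M = L₀`: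

* `prod_riemannTheta_translate_add_intCast`, `prod_riemannTheta_translate_add_mulVec` — every
  `P_x` with `Σ x_v = 0` is `ℤ^g`-periodic and has the SAME factor of automorphy
  `exp(d(-πi ᵗnΩn - 2πi ᵗn z))` along `Ωℤ^g` (that of `L₀^d`): the analytic form of Lemma 2.1.4
  `Σ t*_{x_v} L₀ ≅ L₀^d`; so `z ↦ [P_x(z)]_x` (any finite subfamily) is well defined on `X`;
* `exists_prod_riemannTheta_translate_ne_zero` — **Prop. 2.1.5 at level `d ≥ 2`**: for every `z`
  some `P_x(z) ≠ 0` (no base point);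
* `riemannTheta_lattice_of_prod_translate` — **Thm. 2.1.10 (i) at level `d ≥ 3`**: if
  `P_x(z₂) = γ P_x(z₁)` for all `x` with `Σ x_v = 0`, then `z₂ - z₁ ∈ ℤ^g ⊕ Ωℤ^g`;
* `riemannTheta_tangent_of_prod_translate` — **Thm. 2.1.10 (ii) at level `d ≥ 3`**: if
  `∂_t P_x(z) = μ P_x(z)` for all `x` with `Σ x_v = 0`, then `t = 0`;
* `lefschetz_prod_translate_family` and the Siegel-half-space packagings
  `riemannTheta_prod_translate_basePointFree / _separatesPoints / _separatesTangents` (the typing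
  of `RiemannThetaLefschetzSteps.lean`, with `Fin d`, `Σ x_v = 0` in place of `(a, b, -a-b)`).

Proof (the printed device, made quantitative): the `d - 3` auxiliary translates are taken EQUAL to
one vector `e` with `ϑ(z₁ + e) ϑ(z₂ + e) ≠ 0` — such an `e` exists because `ϑ ≢ 0` and entire
functions on `ℂ^g` form an integral domain (`ThetaRigidity.exists_ne_zero_and_ne_zero`) — and the
remaining three are `s + a, s + b, s - a - b` with `3s + (d-3)e = 0`; then
`P_x(z) = ϑ(z+s+a)ϑ(z+s+b)ϑ(z+s-a-b) · ϑ(z+e)^{d-3}` and the level-`d` hypotheses at `z₁, z₂`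
become the cubic hypotheses at `z₁ + s, z₂ + s` (with another constant), to which the level-three
theorems apply; for (ii) the Leibniz rule splits off the constant `∂_t(ϑ(·+e)^{d-3})(z)/ϑ(z+e)^{d-3}`.
For Prop. 2.1.5: `x = (-(d-1)e, e, …, e)` with `ϑ(z - (d-1)e) ϑ(z + e) ≠ 0`.

NOT reproduced here: the level-`d` theta basis `ϑ[c/d; 0](dz, dΩ)`, `c ∈ (ℤ/dℤ)^g`, and the
level-`d` product formula expressing the `P_x` in it (the tree has `d = 2`:
`RiemannThetaLevelTwo.lean`, and `d = 3`: `RiemannThetaLevelThree.lean`); the reduction of a general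
positive `L` of type `(d₁, …, d_g)` to `M^{d₁}` (Lange, Ex. 1.5.5 (7)) and non-principal `M`.
Everything is proved; no definitions, no named facts. No consumer in the COR-CM chain (which runs at
level three); the file records the printed generality of the theorem the chain cites.

## References

* [Lange2023AbelianVarietiesComplex] H. Lange, Abelian Varieties over the Complex Numbers (2023),
  §2.1 Lemma 2.1.4, Prop. 2.1.5; §2.1.3 Thm. 2.1.10 (Theorem of Lefschetz), proof parts (i), (ii)
  (held text `book:lange1992-complex-abelian-varieties`, PDF pp. 78 and 81).
* [LangeBirkenhake1992] H. Lange, Ch. Birkenhake, Complex Abelian Varieties (1992), Thm. 4.5.1.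
* [MumfordAV1970] D. Mumford, Abelian Varieties (1970), §3 (Theorem of Lefschetz, pp. 29–33).
* [GriffithsHarris1978] P. Griffiths, J. Harris, Principles of Algebraic Geometry (1978), Ch. 2 §6.
-/

noncomputable section

open Complex Real
open Literature.Analysis.Complex

namespace Literature.Analysis.SpecialFunctions

variable {g : ℕ}

/-! ### The test families `(s + a, s + b, s - a - b, e, …, e)` and `(-(k+1)e, e, …, e)` -/

/-- `Σ_v x_v = 3s + k e` for `x = (s + a, s + b, s - a - b, e, …, e)` (`k` copies of `e`). [folklore] -/
private theorem sum_cons_cons_cons_const (e s a b : Fin g → ℂ) (k : ℕ) :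
    ∑ v, (Fin.cons (s + a) (Fin.cons (s + b) (Fin.cons (s - a - b) fun _ : Fin k => e)) :
      Fin (k + 3) → Fin g → ℂ) v = 3 • s + k • e := by
  simp only [Fin.sum_univ_succ, Fin.cons_zero, Fin.cons_succ, Finset.sum_const, Finset.card_univ,
    Fintype.card_fin]
  abel

/-- `∏_v θ(w + x_v) = θ(w+s+a) θ(w+s+b) θ(w+s-a-b) θ(w+e)^k` for `x = (s + a, s + b, s - a - b, e, …, e)`.
[folklore] -/
private theorem prod_cons_cons_cons_const (θ : (Fin g → ℂ) → ℂ) (e s a b w : Fin g → ℂ) (k : ℕ) :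
    ∏ v, θ (w + (Fin.cons (s + a) (Fin.cons (s + b) (Fin.cons (s - a - b) fun _ : Fin k => e)) :
      Fin (k + 3) → Fin g → ℂ) v) =
      θ (w + s + a) * θ (w + s + b) * θ (w + s - a - b) * θ (w + e) ^ k := by
  simp only [Fin.prod_univ_succ, Fin.cons_zero, Fin.cons_succ, Finset.prod_const, Finset.card_univ,
    Fintype.card_fin]
  rw [show w + (s + a) = w + s + a by abel, show w + (s + b) = w + s + b by abel,
    show w + (s - a - b) = w + s - a - b by abel]
  ring

/-- `Σ_v x_v = 0` for `x = (C e, e, …, e)` (`k + 1` copies of `e`), `C = -(k+1)`. [folklore] -/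
private theorem sum_cons_const (e : Fin g → ℂ) (k : ℕ) :
    ∑ v, (Fin.cons ((-((k + 1 : ℕ) : ℂ)) • e) (fun _ : Fin (k + 1) => e) :
      Fin (k + 2) → Fin g → ℂ) v = 0 := by
  simp only [Fin.sum_univ_succ, Fin.cons_zero, Fin.cons_succ, Finset.sum_const, Finset.card_univ,
    Fintype.card_fin]
  funext i
  simp only [Pi.add_apply, Pi.smul_apply, Pi.zero_apply]
  simp only [smul_eq_mul, nsmul_eq_mul]
  push_cast
  ring

/-- `∏_v θ(w + x_v) = θ(w + C e) θ(w+e)^(k+1)` for `x = (C e, e, …, e)`, `C = -(k+1)`. [folklore] -/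
private theorem prod_cons_const (θ : (Fin g → ℂ) → ℂ) (e w : Fin g → ℂ) (k : ℕ) :
    ∏ v, θ (w + (Fin.cons ((-((k + 1 : ℕ) : ℂ)) • e) (fun _ : Fin (k + 1) => e) :
      Fin (k + 2) → Fin g → ℂ) v) =
      θ (w + (-((k + 1 : ℕ) : ℂ)) • e) * θ (w + e) ^ (k + 1) := by
  simp only [Fin.prod_univ_succ, Fin.cons_zero, Fin.cons_succ, Finset.prod_const, Finset.card_univ,
    Fintype.card_fin]

/-- A shift `s` with `3s + k e = 0` (namely `s = -(k/3) e`). [folklore] -/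
private theorem exists_three_nsmul_add_nsmul_eq_zero (e : Fin g → ℂ) (k : ℕ) :
    ∃ s : Fin g → ℂ, 3 • s + k • e = 0 := by
  refine ⟨(-((k : ℂ) / 3)) • e, funext fun i => ?_⟩
  simp only [Pi.add_apply, Pi.smul_apply, Pi.zero_apply]
  simp only [smul_eq_mul, nsmul_eq_mul]
  push_cast
  ring

/-! ### The products `∏_v ϑ(z + x_v)`, `Σ x_v = 0`, are sections of one line bundle `L₀^d` -/

/-- The products `z ↦ ∏_v ϑ(z + x_v)` are entire. [cite: LangeBirkenhake1992, §3.3.2 Prop. 3.3.6] -/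
theorem differentiable_prod_riemannTheta_translate (Ω : Matrix (Fin g) (Fin g) ℂ) {c : ℝ}
    (hc : 0 < c) (hY : ∀ x : Fin g → ℝ, c * ∑ i, x i ^ 2 ≤ ∑ i, ∑ j, x i * (Ω i j).im * x j)
    {ι : Type*} [Fintype ι] (x : ι → Fin g → ℂ) :
    Differentiable ℂ fun z => ∏ v, riemannTheta Ω (z + x v) := by
  classical
  have hd := differentiable_riemannTheta Ω hc hY
  have hv : ∀ v, Differentiable ℂ fun w => riemannTheta Ω (w + x v) :=
    fun v => hd.comp (by fun_prop)
  intro z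
  exact (HasFDerivAt.finsetProd (u := Finset.univ) (g := fun v w => riemannTheta Ω (w + x v))
    (fun v _ => (hv v z).hasFDerivAt)).differentiableAt

/-- **Periodicity**: `∏_v ϑ(z + n + x_v) = ∏_v ϑ(z + x_v)` for `n ∈ ℤ^g` (any finite family of
translates). [cite: LangeBirkenhake1992, §3.3.2] -/
theorem prod_riemannTheta_translate_add_intCast (Ω : Matrix (Fin g) (Fin g) ℂ) {ι : Type*}
    [Fintype ι] (x : ι → Fin g → ℂ) (z : Fin g → ℂ) (n : Fin g → ℤ) :
    ∏ v, riemannTheta Ω ((fun i => z i + n i) + x v) = ∏ v, riemannTheta Ω (z + x v) := by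
  refine Finset.prod_congr rfl fun v _ => ?_
  have e1 : ((fun i => z i + (n i : ℂ)) + x v) = fun i => (z + x v) i + n i := by
    funext i
    simp only [Pi.add_apply]
    ring
  rw [e1, riemannTheta_add_intCast]

/-- **Common quasi-periodicity (analytic form of Lange's Lemma 2.1.4 `Σ_v t*_{x_v} L₀ ≅ L₀^d` for
`Σ_v x_v = 0`).** For symmetric `Ω`, `n ∈ ℤ^g` and `x : Fin d → ℂ^g` with `Σ_v x_v = 0`:
`∏_v ϑ(z + Ωn + x_v) = exp(d(-πi ᵗnΩn - 2πi ᵗn z)) ∏_v ϑ(z + x_v)` — the factor of automorphy of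
`L₀^d`, independent of `x`. [cite: Lange2023AbelianVarietiesComplex, §2.1 Lemma 2.1.4]
[cite: MumfordTata1, Ch. II §1] -/
theorem prod_riemannTheta_translate_add_mulVec (Ω : Matrix (Fin g) (Fin g) ℂ)
    (hΩ : ∀ i j, Ω i j = Ω j i) {d : ℕ} (x : Fin d → Fin g → ℂ) (hx : ∑ v, x v = 0)
    (z : Fin g → ℂ) (n : Fin g → ℤ) :
    ∏ v, riemannTheta Ω ((fun i => z i + ∑ j, Ω i j * (n j : ℂ)) + x v) =
      cexp ((d : ℂ) * (-(π * I * ∑ i, ∑ j, (n i : ℂ) * Ω i j * (n j : ℂ)) -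
        2 * π * I * ∑ i, (n i : ℂ) * z i)) * ∏ v, riemannTheta Ω (z + x v) := by
  -- quasi-periodicity of each factor
  have hfac : ∀ v, riemannTheta Ω ((fun i => z i + ∑ j, Ω i j * (n j : ℂ)) + x v) =
      cexp (-(π * I * ∑ i, ∑ j, (n i : ℂ) * Ω i j * (n j : ℂ)) -
          2 * π * I * ∑ i, (n i : ℂ) * (z + x v) i) * riemannTheta Ω (z + x v) := by
    intro v
    have e1 : ((fun i => z i + ∑ j, Ω i j * (n j : ℂ)) + x v) =
        fun i => (z + x v) i + ∑ j, Ω i j * (n j : ℂ) := by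
      funext i
      simp only [Pi.add_apply]
      ring
    rw [e1, riemannTheta_add_mulVec Ω hΩ]
  rw [Finset.prod_congr rfl fun v _ => hfac v, Finset.prod_mul_distrib, ← Complex.exp_sum]
  congr 2
  -- the exponents: `Σ_v x_v = 0` kills the `x`-dependence
  have hxi : ∀ i, ∑ v, x v i = 0 := fun i => by
    simpa [Finset.sum_apply] using congrFun hx i
  have hT : ∀ v, ∑ i, (n i : ℂ) * (z + x v) i = ∑ i, (n i : ℂ) * z i + ∑ i, (n i : ℂ) * x v i := by
    intro v
    rw [← Finset.sum_add_distrib]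
    exact Finset.sum_congr rfl fun i _ => by rw [Pi.add_apply, mul_add]
  have hT0 : ∑ v, ∑ i, (n i : ℂ) * x v i = 0 := by
    rw [Finset.sum_comm]
    exact Finset.sum_eq_zero fun i _ => by rw [← Finset.mul_sum, hxi i, mul_zero]
  calc ∑ v, (-(π * I * ∑ i, ∑ j, (n i : ℂ) * Ω i j * (n j : ℂ)) -
          2 * π * I * ∑ i, (n i : ℂ) * (z + x v) i)
      = ∑ v, ((-(π * I * ∑ i, ∑ j, (n i : ℂ) * Ω i j * (n j : ℂ)) -
          2 * π * I * ∑ i, (n i : ℂ) * z i) - 2 * π * I * ∑ i, (n i : ℂ) * x v i) :=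
        Finset.sum_congr rfl fun v _ => by rw [hT v]; ring
    _ = (d : ℂ) * (-(π * I * ∑ i, ∑ j, (n i : ℂ) * Ω i j * (n j : ℂ)) -
          2 * π * I * ∑ i, (n i : ℂ) * z i) := by
        rw [Finset.sum_sub_distrib, Finset.sum_const, Finset.card_univ, Fintype.card_fin,
          ← Finset.mul_sum, hT0, mul_zero, sub_zero, nsmul_eq_mul]

/-! ### Prop. 2.1.5 at level `d ≥ 2`: no base point -/

/-- **No base point at level `d ≥ 2`** (Lange, Prop. 2.1.5 "`d₁ ≥ 2 ⇒ φ_L` is holomorphic", for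
`L = L₀^d` on `ℂ^g/(ℤ^g ⊕ Ωℤ^g)`, with Lange's proof): for every `z` there are `x₁, …, x_d` with
`Σ x_v = 0` and `∏_v ϑ(z + x_v) ≠ 0`, i.e. the divisor `Σ_v t*_{x_v}Θ ∈ |L₀^d|` misses `z`. (Take
`x = (-(d-1)e, e, …, e)` with `ϑ(z - (d-1)e) ϑ(z + e) ≠ 0`: both factors are entire functions of
`e`, not identically zero since `ϑ ≢ 0`, and entire functions form an integral domain.)
[cite: Lange2023AbelianVarietiesComplex, §2.1 Prop. 2.1.5 (proof)] -/
theorem exists_prod_riemannTheta_translate_ne_zero (Ω : Matrix (Fin g) (Fin g) ℂ) {c : ℝ}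
    (hc : 0 < c) (hY : ∀ x : Fin g → ℝ, c * ∑ i, x i ^ 2 ≤ ∑ i, ∑ j, x i * (Ω i j).im * x j)
    {d : ℕ} (hd : 2 ≤ d) (z : Fin g → ℂ) :
    ∃ x : Fin d → Fin g → ℂ, ∑ v, x v = 0 ∧ ∏ v, riemannTheta Ω (z + x v) ≠ 0 := by
  obtain ⟨k, rfl⟩ : ∃ k, d = k + 2 := ⟨d - 2, by omega⟩
  have hdiff := differentiable_riemannTheta Ω hc hY
  obtain ⟨x₀, hx₀⟩ := exists_riemannTheta_ne_zero Ω hc hY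
  have hC0 : (-((k + 1 : ℕ) : ℂ)) ≠ 0 := by
    rw [neg_ne_zero, Nat.cast_ne_zero]
    omega
  -- `F(e) = ϑ(z + e)` and `G(e) = ϑ(z + C e)` are entire and not identically zero
  have hF : Differentiable ℂ fun e : Fin g → ℂ => riemannTheta Ω (z + e) := hdiff.comp (by fun_prop)
  have hG : Differentiable ℂ fun e : Fin g → ℂ => riemannTheta Ω (z + (-((k + 1 : ℕ) : ℂ)) • e) :=
    hdiff.comp (by fun_prop)
  have hF0 : (fun e : Fin g → ℂ => riemannTheta Ω (z + e)) ≠ 0 := by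
    intro h
    have h1 := congrFun h (x₀ - z)
    simp only [add_sub_cancel, Pi.zero_apply] at h1
    exact hx₀ h1
  have hG0 : (fun e : Fin g → ℂ => riemannTheta Ω (z + (-((k + 1 : ℕ) : ℂ)) • e)) ≠ 0 := by
    intro h
    have h1 := congrFun h ((-((k + 1 : ℕ) : ℂ))⁻¹ • (x₀ - z))
    have h2 : z + (-((k + 1 : ℕ) : ℂ)) • (-((k + 1 : ℕ) : ℂ))⁻¹ • (x₀ - z) = x₀ := by
      rw [smul_smul, mul_inv_cancel₀ hC0, one_smul, add_sub_cancel]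
    simp only [h2, Pi.zero_apply] at h1
    exact hx₀ h1
  obtain ⟨e, heF, heG⟩ := ThetaRigidity.exists_ne_zero_and_ne_zero hF hG hF0 hG0
  refine ⟨Fin.cons ((-((k + 1 : ℕ) : ℂ)) • e) fun _ => e, sum_cons_const e k, ?_⟩
  rw [prod_cons_const]
  exact mul_ne_zero heG (pow_ne_zero _ heF)

/-! ### Thm. 2.1.10 (i) at level `d ≥ 3`: separation of points modulo the lattice -/

/-- **Theorem of Lefschetz, part (i), at level `d ≥ 3`** (Lange, Thm. 2.1.10 (i), for `L = L₀^d`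
on `ℂ^g/(ℤ^g ⊕ Ωℤ^g)`): if two points `z₁, z₂` are not separated by the divisors
`Σ_{v=1}^{d} t*_{x_v}Θ`, `x₁ + ⋯ + x_d = 0` — i.e. `∏_v ϑ(z₂ + x_v) = γ ∏_v ϑ(z₁ + x_v)` for one
constant `γ` and all such `x` — then `z₂ - z₁ ∈ ℤ^g ⊕ Ωℤ^g`. (The `d - 3` auxiliary translates are
chosen equal to an `e` with `ϑ(z₁ + e) ϑ(z₂ + e) ≠ 0` — Lange's "`y₂ ∉ t*_{x_v} D_M` for
`v = 2, …, d₁`" — which reduces the hypothesis to the cubic one for `z₁ + s, z₂ + s`,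
`3s + (d-3)e = 0`, settled by `riemannTheta_lattice_of_cubic_translate`.)
[cite: Lange2023AbelianVarietiesComplex, §2.1.3 Thm. 2.1.10 (proof, part (i))]
[cite: LangeBirkenhake1992, Thm. 4.5.1] [cite: MumfordAV1970, §3 (Theorem of Lefschetz)] -/
theorem riemannTheta_lattice_of_prod_translate (Ω : Matrix (Fin g) (Fin g) ℂ)
    (hΩ : ∀ i j, Ω i j = Ω j i) {c : ℝ} (hc : 0 < c)
    (hY : ∀ x : Fin g → ℝ, c * ∑ i, x i ^ 2 ≤ ∑ i, ∑ j, x i * (Ω i j).im * x j)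
    {d : ℕ} (hd : 3 ≤ d) {z₁ z₂ : Fin g → ℂ} {γ : ℂ}
    (h : ∀ x : Fin d → Fin g → ℂ, ∑ v, x v = 0 →
      ∏ v, riemannTheta Ω (z₂ + x v) = γ * ∏ v, riemannTheta Ω (z₁ + x v)) :
    ∃ m n : Fin g → ℤ, ∀ i, z₂ i - z₁ i = (m i : ℂ) + ∑ j, Ω i j * (n j : ℂ) := by
  obtain ⟨k, rfl⟩ : ∃ k, d = k + 3 := ⟨d - 3, by omega⟩
  have hdiff := differentiable_riemannTheta Ω hc hY
  obtain ⟨x₀, hx₀⟩ := exists_riemannTheta_ne_zero Ω hc hY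
  -- an auxiliary translate `e` off both points
  have hF : ∀ z : Fin g → ℂ, Differentiable ℂ fun e : Fin g → ℂ => riemannTheta Ω (z + e) :=
    fun z => hdiff.comp (by fun_prop)
  have hF0 : ∀ z : Fin g → ℂ, (fun e : Fin g → ℂ => riemannTheta Ω (z + e)) ≠ 0 := by
    intro z habs
    have h1 := congrFun habs (x₀ - z)
    simp only [add_sub_cancel, Pi.zero_apply] at h1
    exact hx₀ h1
  obtain ⟨e, he₁, he₂⟩ :=
    ThetaRigidity.exists_ne_zero_and_ne_zero (hF z₁) (hF z₂) (hF0 z₁) (hF0 z₂)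
  have hA : riemannTheta Ω (z₂ + e) ^ k ≠ 0 := pow_ne_zero _ he₂
  -- the shift `s`, `3s + k e = 0`
  obtain ⟨s, hs⟩ := exists_three_nsmul_add_nsmul_eq_zero e k
  -- the cubic hypothesis for the shifted points
  have hcubic : ∀ a b : Fin g → ℂ,
      riemannTheta Ω (z₂ + s + a) * riemannTheta Ω (z₂ + s + b) * riemannTheta Ω (z₂ + s - a - b) =
        γ * riemannTheta Ω (z₁ + e) ^ k / riemannTheta Ω (z₂ + e) ^ k *
          (riemannTheta Ω (z₁ + s + a) * riemannTheta Ω (z₁ + s + b) *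
            riemannTheta Ω (z₁ + s - a - b)) := by
    intro a b
    have H := h (Fin.cons (s + a) (Fin.cons (s + b) (Fin.cons (s - a - b) fun _ : Fin k => e)))
      (by rw [sum_cons_cons_cons_const, hs])
    rw [prod_cons_cons_cons_const, prod_cons_cons_cons_const] at H
    rw [div_mul_eq_mul_div, eq_div_iff hA]
    linear_combination H
  obtain ⟨m, n, hmn⟩ := riemannTheta_lattice_of_cubic_translate Ω hΩ hc hY hcubic
  exact ⟨m, n, fun i => by simpa using hmn i⟩

/-! ### Thm. 2.1.10 (ii) at level `d ≥ 3`: separation of tangent vectors -/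

/-- **Theorem of Lefschetz, part (ii), at level `d ≥ 3`** (Lange, Thm. 2.1.10 (ii), for `L = L₀^d`
on `ℂ^g/(ℤ^g ⊕ Ωℤ^g)`): if a tangent vector `t` at `z` is tangent at `z` to all the divisors
`Σ_{v=1}^{d} t*_{x_v}Θ`, `x₁ + ⋯ + x_d = 0`, through `z` — in the form
`∂_t(∏_v ϑ(· + x_v))(z) = μ ∏_v ϑ(z + x_v)` for one constant `μ` and all such `x` — then `t = 0`.
(Same device: `x = (s + a, s + b, s - a - b, e, …, e)` with `ϑ(z + e) ≠ 0`; the Leibniz rule splits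
off the constant `∂_t(ϑ(· + e)^{d-3})(z) / ϑ(z + e)^{d-3}`, leaving the cubic Leibniz hypothesis at
`z + s`, settled by `riemannTheta_tangent_of_cubic_leibniz`.)
[cite: Lange2023AbelianVarietiesComplex, §2.1.3 Thm. 2.1.10 (proof, part (ii))]
[cite: LangeBirkenhake1992, Thm. 4.5.1] [cite: MumfordAV1970, §3 (Theorem of Lefschetz)] -/
theorem riemannTheta_tangent_of_prod_translate (Ω : Matrix (Fin g) (Fin g) ℂ)
    (hΩ : ∀ i j, Ω i j = Ω j i) {c : ℝ} (hc : 0 < c)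
    (hY : ∀ x : Fin g → ℝ, c * ∑ i, x i ^ 2 ≤ ∑ i, ∑ j, x i * (Ω i j).im * x j)
    {d : ℕ} (hd : 3 ≤ d) {z t : Fin g → ℂ} {μ : ℂ}
    (h : ∀ x : Fin d → Fin g → ℂ, ∑ v, x v = 0 →
      fderiv ℂ (fun w => ∏ v, riemannTheta Ω (w + x v)) z t = μ * ∏ v, riemannTheta Ω (z + x v)) :
    t = 0 := by
  obtain ⟨k, rfl⟩ : ∃ k, d = k + 3 := ⟨d - 3, by omega⟩
  have hdiff := differentiable_riemannTheta Ω hc hY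
  obtain ⟨x₀, hx₀⟩ := exists_riemannTheta_ne_zero Ω hc hY
  -- `e` with `ϑ(z + e) ≠ 0`
  obtain ⟨e, he⟩ : ∃ e : Fin g → ℂ, riemannTheta Ω (z + e) ≠ 0 := ⟨x₀ - z, by rwa [add_sub_cancel]⟩
  have hA : riemannTheta Ω (z + e) ^ k ≠ 0 := pow_ne_zero _ he
  obtain ⟨s, hs⟩ := exists_three_nsmul_add_nsmul_eq_zero e k
  -- the auxiliary factor `F(w) = ϑ(w + e)^k` and its `t`-derivative `ν` at `z`
  have hFd : DifferentiableAt ℂ (fun w : Fin g → ℂ => riemannTheta Ω (w + e) ^ k) z := by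
    fun_prop
  obtain ⟨ν, hν⟩ : ∃ ν : ℂ, fderiv ℂ (fun w : Fin g → ℂ => riemannTheta Ω (w + e) ^ k) z t = ν :=
    ⟨_, rfl⟩
  refine riemannTheta_tangent_of_cubic_leibniz Ω hΩ hc hY (z := z + s) (v := t)
    (μ := μ - ν / riemannTheta Ω (z + e) ^ k) fun a b => ?_
  have H := h (Fin.cons (s + a) (Fin.cons (s + b) (Fin.cons (s - a - b) fun _ : Fin k => e)))
    (by rw [sum_cons_cons_cons_const, hs])
  rw [prod_cons_cons_cons_const,
    show (fun w => ∏ v, riemannTheta Ω (w + (Fin.cons (s + a) (Fin.cons (s + b)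
        (Fin.cons (s - a - b) fun _ : Fin k => e)) : Fin (k + 3) → Fin g → ℂ) v)) =
      fun w => riemannTheta Ω (w + s + a) * riemannTheta Ω (w + s + b) *
        riemannTheta Ω (w + s - a - b) * riemannTheta Ω (w + e) ^ k from
      funext fun w => prod_cons_cons_cons_const (riemannTheta Ω) e s a b w k] at H
  -- the derivative of the cubic factor at `z` is the cubic Leibniz form at `z + s`
  have h1 : HasFDerivAt (fun w : Fin g → ℂ => riemannTheta Ω (w + s + a) *
      riemannTheta Ω (w + s + b) * riemannTheta Ω (w + s - a - b))
      ((riemannTheta Ω (z + s + a) * riemannTheta Ω (z + s + b)) •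
          fderiv ℂ (riemannTheta Ω) (z + s - a - b) +
        riemannTheta Ω (z + s - a - b) •
          (riemannTheta Ω (z + s + a) • fderiv ℂ (riemannTheta Ω) (z + s + b) +
            riemannTheta Ω (z + s + b) • fderiv ℂ (riemannTheta Ω) (z + s + a))) z :=
    (hasFDerivAt_comp_add_right (f := fun y => riemannTheta Ω (y + a) * riemannTheta Ω (y + b) *
      riemannTheta Ω (y - a - b)) s).mpr (hasFDerivAt_riemannTheta_cubic Ω hc hY a b (z + s))
  have h2 : HasFDerivAt (fun w : Fin g → ℂ => riemannTheta Ω (w + s + a) *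
      riemannTheta Ω (w + s + b) * riemannTheta Ω (w + s - a - b) * riemannTheta Ω (w + e) ^ k)
      ((riemannTheta Ω (z + s + a) * riemannTheta Ω (z + s + b) * riemannTheta Ω (z + s - a - b)) •
          fderiv ℂ (fun w : Fin g → ℂ => riemannTheta Ω (w + e) ^ k) z +
        riemannTheta Ω (z + e) ^ k •
          ((riemannTheta Ω (z + s + a) * riemannTheta Ω (z + s + b)) •
              fderiv ℂ (riemannTheta Ω) (z + s - a - b) +
            riemannTheta Ω (z + s - a - b) •
              (riemannTheta Ω (z + s + a) • fderiv ℂ (riemannTheta Ω) (z + s + b) +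
                riemannTheta Ω (z + s + b) • fderiv ℂ (riemannTheta Ω) (z + s + a)))) z :=
    h1.mul hFd.hasFDerivAt
  rw [h2.fderiv] at H
  simp only [_root_.add_apply, FunLike.coe_smul, Pi.smul_apply, smul_eq_mul, hν] at H
  -- `H : c ν + ϑ(z+e)^k · Leibniz = μ (c · ϑ(z+e)^k)`; divide by `ϑ(z+e)^k`
  rw [show μ - ν / riemannTheta Ω (z + e) ^ k = (μ * riemannTheta Ω (z + e) ^ k - ν) /
      riemannTheta Ω (z + e) ^ k by rw [sub_div, mul_div_cancel_right₀ _ hA],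
    div_mul_eq_mul_div, eq_div_iff hA]
  linear_combination H

/-! ### The package -/

/-- **Lefschetz's theorem at level `d ≥ 3` for `ℂ^g/(ℤ^g ⊕ Ωℤ^g)`, analytic form** (symmetric `Ω`,
`Im Ω ≥ c > 0`): the family of products `P_x(z) = ∏_{v=1}^{d} ϑ(z + x_v)`, `x : Fin d → ℂ^g`,
consists of entire, `ℤ^g`-periodic functions; those with `Σ_v x_v = 0` have the common factor of
automorphy `exp(d(-πi ᵗnΩn - 2πi ᵗn z))` along `Ωℤ^g` (sections of `L₀^d`), have no common zero,
separate points modulo `ℤ^g ⊕ Ωℤ^g`, and separate tangent vectors.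
[cite: Lange2023AbelianVarietiesComplex, §2.1.3 Thm. 2.1.10] [cite: LangeBirkenhake1992, Thm. 4.5.1]
[cite: MumfordAV1970, §3 (Theorem of Lefschetz)] [cite: GriffithsHarris1978, Ch. 2 §6] -/
theorem lefschetz_prod_translate_family (Ω : Matrix (Fin g) (Fin g) ℂ)
    (hΩ : ∀ i j, Ω i j = Ω j i) {c : ℝ} (hc : 0 < c)
    (hY : ∀ x : Fin g → ℝ, c * ∑ i, x i ^ 2 ≤ ∑ i, ∑ j, x i * (Ω i j).im * x j)
    {d : ℕ} (hd : 3 ≤ d) :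
    (∀ x : Fin d → Fin g → ℂ, Differentiable ℂ fun z => ∏ v, riemannTheta Ω (z + x v)) ∧
    (∀ (x : Fin d → Fin g → ℂ) (z : Fin g → ℂ) (n : Fin g → ℤ),
      ∏ v, riemannTheta Ω ((fun i => z i + n i) + x v) = ∏ v, riemannTheta Ω (z + x v)) ∧
    (∀ x : Fin d → Fin g → ℂ, ∑ v, x v = 0 → ∀ (z : Fin g → ℂ) (n : Fin g → ℤ),
      ∏ v, riemannTheta Ω ((fun i => z i + ∑ j, Ω i j * (n j : ℂ)) + x v) =
        cexp ((d : ℂ) * (-(π * I * ∑ i, ∑ j, (n i : ℂ) * Ω i j * (n j : ℂ)) -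
          2 * π * I * ∑ i, (n i : ℂ) * z i)) * ∏ v, riemannTheta Ω (z + x v)) ∧
    (∀ z : Fin g → ℂ, ∃ x : Fin d → Fin g → ℂ, ∑ v, x v = 0 ∧ ∏ v, riemannTheta Ω (z + x v) ≠ 0) ∧
    (∀ (z₁ z₂ : Fin g → ℂ) (γ : ℂ),
      (∀ x : Fin d → Fin g → ℂ, ∑ v, x v = 0 →
        ∏ v, riemannTheta Ω (z₂ + x v) = γ * ∏ v, riemannTheta Ω (z₁ + x v)) →
      ∃ m n : Fin g → ℤ, ∀ i, z₂ i - z₁ i = (m i : ℂ) + ∑ j, Ω i j * (n j : ℂ)) ∧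
    (∀ (z t : Fin g → ℂ) (μ : ℂ),
      (∀ x : Fin d → Fin g → ℂ, ∑ v, x v = 0 →
        fderiv ℂ (fun w => ∏ v, riemannTheta Ω (w + x v)) z t = μ * ∏ v, riemannTheta Ω (z + x v)) →
      t = 0) :=
  ⟨fun x => differentiable_prod_riemannTheta_translate Ω hc hY x,
    fun x z n => prod_riemannTheta_translate_add_intCast Ω x z n,
    fun x hx z n => prod_riemannTheta_translate_add_mulVec Ω hΩ x hx z n,
    fun z => exists_prod_riemannTheta_translate_ne_zero Ω hc hY (le_trans (by norm_num) hd) z,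
    fun _ _ _ hγ => riemannTheta_lattice_of_prod_translate Ω hΩ hc hY hd hγ,
    fun _ _ _ hμ => riemannTheta_tangent_of_prod_translate Ω hΩ hc hY hd hμ⟩

/-! ### Siegel upper half space packagings (the typing of `RiemannThetaLefschetzSteps.lean`) -/

/-- **No base point at level `d ≥ 2`**, for `Ω` symmetric with positive definite imaginary part.
[cite: Lange2023AbelianVarietiesComplex, §2.1 Prop. 2.1.5] -/
theorem riemannTheta_prod_translate_basePointFree :
    ∀ ⦃n : ℕ⦄ (Ω : Matrix (Fin n) (Fin n) ℂ), (Ω.map Complex.im).PosDef →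
      ∀ ⦃d : ℕ⦄, 2 ≤ d → ∀ z : Fin n → ℂ,
      ∃ x : Fin d → Fin n → ℂ, ∑ v, x v = 0 ∧ ∏ v, riemannTheta Ω (z + x v) ≠ 0 := by
  intro n Ω hpos d hd z
  obtain ⟨c, hc, hY⟩ := exists_pos_mul_sum_sq_le_of_posDef_im Ω hpos
  exact exists_prod_riemannTheta_translate_ne_zero Ω hc hY hd z

/-- **The level-`d` theta products separate points modulo the lattice (`d ≥ 3`)**, for `Ω` symmetric
with positive definite imaginary part: if `∏_v ϑ(z₂ + x_v) = c ∏_v ϑ(z₁ + x_v)` for all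
`x : Fin d → ℂⁿ` with `Σ_v x_v = 0`, then `z₂ - z₁ = p + Ωq` with `p, q ∈ ℤⁿ`. At `d = 3`
(`x = (a, b, -a-b)`) this is `riemannTheta_cubic_separatesPoints`.
[cite: Lange2023AbelianVarietiesComplex, §2.1.3 Thm. 2.1.10 (i)] [cite: LangeBirkenhake1992, Thm. 4.5.1]
[cite: MumfordAV1970, §3 (Theorem of Lefschetz)] -/
theorem riemannTheta_prod_translate_separatesPoints :
    ∀ ⦃n : ℕ⦄ (Ω : Matrix (Fin n) (Fin n) ℂ), (∀ i j, Ω i j = Ω j i) → (Ω.map Complex.im).PosDef →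
      ∀ ⦃d : ℕ⦄, 3 ≤ d → ∀ (z₁ z₂ : Fin n → ℂ) (c : ℂ),
      (∀ x : Fin d → Fin n → ℂ, ∑ v, x v = 0 →
        ∏ v, riemannTheta Ω (z₂ + x v) = c * ∏ v, riemannTheta Ω (z₁ + x v)) →
      ∃ p q : Fin n → ℤ, z₂ - z₁ = fun i => (p i : ℂ) + ∑ j, Ω i j * (q j : ℂ) := by
  intro n Ω hΩ hpos d hd z₁ z₂ c h
  obtain ⟨c', hc', hY⟩ := exists_pos_mul_sum_sq_le_of_posDef_im Ω hpos
  obtain ⟨p, q, hpq⟩ := riemannTheta_lattice_of_prod_translate Ω hΩ hc' hY hd h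
  exact ⟨p, q, funext fun i => by rw [Pi.sub_apply]; exact hpq i⟩

/-- **The level-`d` theta products separate tangent vectors (`d ≥ 3`)**, for `Ω` symmetric with
positive definite imaginary part: if `∂_t (∏_v ϑ(· + x_v))(z) = c ∏_v ϑ(z + x_v)` for all
`x : Fin d → ℂⁿ` with `Σ_v x_v = 0`, then `t = 0`. At `d = 3` this is
`riemannTheta_cubic_separatesTangents`.
[cite: Lange2023AbelianVarietiesComplex, §2.1.3 Thm. 2.1.10 (ii)] [cite: LangeBirkenhake1992, Thm. 4.5.1]
[cite: MumfordAV1970, §3 (Theorem of Lefschetz)] -/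
theorem riemannTheta_prod_translate_separatesTangents :
    ∀ ⦃n : ℕ⦄ (Ω : Matrix (Fin n) (Fin n) ℂ), (∀ i j, Ω i j = Ω j i) → (Ω.map Complex.im).PosDef →
      ∀ ⦃d : ℕ⦄, 3 ≤ d → ∀ (z t : Fin n → ℂ) (c : ℂ),
      (∀ x : Fin d → Fin n → ℂ, ∑ v, x v = 0 →
        fderiv ℂ (fun w => ∏ v, riemannTheta Ω (w + x v)) z t = c * ∏ v, riemannTheta Ω (z + x v)) →
      t = 0 := by
  intro n Ω hΩ hpos d hd z t c h
  obtain ⟨c', hc', hY⟩ := exists_pos_mul_sum_sq_le_of_posDef_im Ω hpos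
  exact riemannTheta_tangent_of_prod_translate Ω hΩ hc' hY hd h

end Literature.Analysis.SpecialFunctions

end
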